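import Summits.BirchSwinnertonDyer.Rank1Residual.X11a.SelmerCompanionBound
import Literature.NumberTheory.EllipticCurves.MazurRubin2015.KummerImageGoodReduction
import HarnessLib

/-!
# Selmer COMPANIONS: `#Sel^(p)(E'/K) = #Sel^(p)(E/K)` when the local Selmer conditions of two
# `p`-congruent curves agree at every place (cell `b2b-bsdres`, unit `b2b-bsdres-x10` = N2 class
# lead, GEN 27; TOOL — theorems only, no definition, no named fact of its own, nothing booked)

HONEST FRAMING (run/shared/lean/b2b/bsd-rank1-residual/, verbatim in every file): the goal of the
cell is to DELETE the COMBINATION-SHAPED residual classes of the Birch–Swinnerton-Dyer formula for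
ALL analytic-rank `≤ 1` elliptic curves over `ℚ` — "full BSD formula for every rank `≤ 1` curve in
class `C`" assembled STRICTLY from published theorems — so that the rank-`≤ 1` remainder becomes
exactly the CONSTRUCTION-SHAPED classes, which are TYPED (missing-input `Prop`s), NOT attempted.
This is not "finishing BSD". Class X10b (= N2) keeps its label CONSTRUCTION-SHAPED (NEEDS `X_A3`,
referee R82.3 / RESIDUAL-MAP §I N2); this file is a TOOL; no mark / label / tier / count moves.

## What

x11a GEN 26 proved the one-sided congruence transport
`Summit.BirchSwinnertonDyer.Rank1Residual.X11a.SelmerCompanion.natCard_selmerGroup_le_of_congr`: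
`#Sel^(p)(E'/K) ≤ #Sel^(p)(E/K) · ∏_{v ∈ S} ι_v(θ)` along a `Γ_K`-isomorphism `θ : E'[p] ⥲ E[p]`
(`p` odd; `S` ⊇ the bad places of both curves and the places above `p`). This file records the
two-sided consequence the N2 lane uses (X10-AUDIT §33, memo `class-closure/N2/TRIVIAL-ROADS-x10g27.md`):

* `natCard_selmerGroup_eq_of_congr_of_agree` — if at every `v ∈ S` the local conditions AGREE along
  `θ` in both directions (`θ_* 𝓢_v(E') ≤ 𝓢_v(E)` and `θ_*⁻¹ 𝓢_v(E) ≤ 𝓢_v(E')`), then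
  **`#Sel^(p)(E'/K) = #Sel^(p)(E/K)`** — the two curves are `p`-SELMER COMPANIONS in the sense of
  Mazur–Rubin, *Selmer companion curves*, Trans. AMS 367 (2015);
* `natCard_selmerGroup_eq_of_congr_of_agree_rat` — over `ℚ`, with both curves GOOD at `p`, the
  agreement at the place above `p` is Mazur–Rubin 2015 Thm. 3.1 (iv)(b) (Raynaud, `e = 1 < p − 1`), the
  tree's NAMED FACT `MazurRubin2015.selmerLocalKer_iff_of_goodReduction_above` (`hMR`); only the finite
  places `v ∤ p` of `S` keep an agreement hypothesis, to be discharged per pair by the tree's criteria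
  (`relIndex_map_selmerLocalKer_eq_one_of_hasGoodReductionAt`, `…_of_card_torsion_eq_one` — e.g. at an
  ADDITIVE place `v ∤ 3` of an N2 cell, where `E(ℚ_v)[3] = 0` —, `selmerLocalKer_iff_h1Equiv_of_nonsplit_good_of_not_mem`
  (n1011: Fisher 2016 Thm. 4.4 at `v ∤ p`, proved), `h1Equiv_mem_selmerLocalKer_of_hasMultiplicativeReductionAt`).

N2 READING (evidence, not a theorem of this file): for an N2 cell `E` (good ordinary at `3`, `E[3]`
irreducible with image `3Ns/3Nn`) and ANY curve `A` with `A[3] ≅ E[3]`, good at `3` and `3 ∤ ∏ c_ℓ(A)`,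
the local conditions of `A` are "unramified" at every `ℓ ≠ 3` (Milne *ADT* I.3.8 + Kodaira–Néron), so
all such `A` are `3`-Selmer companions OF EACH OTHER: `Sel^(3)(A/ℚ)` is one group `S⁰(E)`; census of
the law on 410 + 229 certified congruent pairs in Cremona's table and on > 10⁴ Hesse-family members
beyond it: 0 violations (X10-AUDIT §33).

## References

* [MazurRubin2015SelmerCompanions] B. Mazur, K. Rubin, *Selmer companion curves*, Trans. Amer.
  Math. Soc. 367 (2015) 401–421, Thm. 3.1.
* [MazurRubin2004] B. Mazur, K. Rubin, *Kolyvagin systems*, Mem. AMS 799 (2004), §2.3.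
* [MilneADT2006] J. S. Milne, *Arithmetic Duality Theorems*, 2nd ed., I Lemma 3.3, Prop. 3.8.
* HOME/class-closure/N2/TRIVIAL-ROADS-x10g27.md; HOME/X10-AUDIT.md §33.
-/

set_option autoImplicit false

noncomputable section

open scoped Classical

open WeierstrassCurve Literature.NumberTheory.EllipticCurves
  Literature.NumberTheory.GaloisRepresentations Field NumberField IsDedekindDomain
open Summit.BirchSwinnertonDyer.Rank1Residual.X11a.SelmerCompanion
open Literature.NumberTheory.EllipticCurves.MazurRubin2015

namespace Summit.BirchSwinnertonDyer.Rank1Residual.X10.SelmerCompanions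

section General

variable {K : Type} [Field K] [NumberField K] (W W' : WeierstrassCurve K) [W.IsElliptic]
  [W'.IsElliptic] {p : ℕ} [Fact p.Prime]

/-- **Selmer companions.** Let `E = W`, `E' = W'` be elliptic curves over a number field `K`, `p` an odd
prime, `θ : E'[p] ⥲ E[p]` a `Γ_K`-equivariant isomorphism with transport `θ_* = h1Equiv θ` on `H¹(K, ·)`,
and `S` a finite set of finite places containing every place of bad reduction of `E` or `E'` and every
place above `p`. If at every `v ∈ S` the local Selmer conditions agree along `θ` in BOTH directions —
`θ_* 𝓢_v(E') ≤ 𝓢_v(E)` and `θ_*⁻¹ 𝓢_v(E) ≤ 𝓢_v(E')` (`𝓢_v(·) = selmerLocalKer · K_v p`) — then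
**`#Sel^(p)(E'/K) = #Sel^(p)(E/K)`**: the x11a bound `natCard_selmerGroup_le_of_congr_of_le_off` with
`T = ∅` applied to `θ` and to `θ⁻¹` (`θ⁻¹` is equivariant, `symm_equivariant`; `h1Equiv θ⁻¹ = (h1Equiv θ)⁻¹`
by definition). [cite: MazurRubin2015SelmerCompanions, Thm. 3.1] [cite: MazurRubin2004, §2.3] -/
theorem natCard_selmerGroup_eq_of_congr_of_agree (hp2 : p ≠ 2)
    (θ : geomTorsion W' (p : ℤ) ≃+ geomTorsion W (p : ℤ))
    (hθ : ∀ (σ : absoluteGaloisGroup K) (P : geomTorsion W' (p : ℤ)), θ (σ • P) = σ • θ P)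
    (S : Finset (HeightOneSpectrum (𝓞 K)))
    (hS : ∀ v : HeightOneSpectrum (𝓞 K), v ∉ S →
      W.HasGoodReductionAt v ∧ W'.HasGoodReductionAt v ∧ (p : 𝓞 K) ∉ v.asIdeal)
    (hto : ∀ v ∈ S, ∀ c ∈ selmerLocalKer W' (v.adicCompletion K) (p : ℤ),
      h1Equiv θ hθ c ∈ selmerLocalKer W (v.adicCompletion K) (p : ℤ))
    (hfro : ∀ v ∈ S, ∀ c ∈ selmerLocalKer W (v.adicCompletion K) (p : ℤ),
      (h1Equiv θ hθ).symm c ∈ selmerLocalKer W' (v.adicCompletion K) (p : ℤ)) :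
    Nat.card (W'.selmerGroup (p : ℤ)) = Nat.card (W.selmerGroup (p : ℤ)) := by
  apply le_antisymm
  · have h := natCard_selmerGroup_le_of_congr_of_le_off W W' hp2 θ hθ S ∅ (Finset.empty_subset S) hS
      (fun v hv _ ↦ hto v hv)
    simpa using h
  · have hS' : ∀ v : HeightOneSpectrum (𝓞 K), v ∉ S →
        W'.HasGoodReductionAt v ∧ W.HasGoodReductionAt v ∧ (p : 𝓞 K) ∉ v.asIdeal :=
      fun v hv ↦ ⟨(hS v hv).2.1, (hS v hv).1, (hS v hv).2.2⟩
    have h := natCard_selmerGroup_le_of_congr_of_le_off W' W hp2 θ.symm (symm_equivariant θ hθ) S ∅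
      (Finset.empty_subset S) hS' (fun v hv _ c hc ↦ hfro v hv c hc)
    simpa using h

omit [NumberField K] [W.IsElliptic] [W'.IsElliptic] [Fact p.Prime] in
/-- The reverse agreement at `v` follows from an `iff`-shaped agreement (the shape of the tree's named
facts `MazurRubin2015.selmerLocalKer_iff_of_goodReduction_above`, `Fisher2016.thm44_…`, and of
`selmerLocalKer_iff_h1Equiv_of_nonsplit_good_of_not_mem`): if `c' ∈ 𝓢_v(E') ↔ θ_* c' ∈ 𝓢_v(E)` for
every `c'`, then `θ_*⁻¹ 𝓢_v(E) ≤ 𝓢_v(E')`. [folklore] -/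
theorem symm_mem_selmerLocalKer_of_iff {L : Type} [Field L] [Algebra K L]
    (θ : geomTorsion W' (p : ℤ) ≃+ geomTorsion W (p : ℤ))
    (hθ : ∀ (σ : absoluteGaloisGroup K) (P : geomTorsion W' (p : ℤ)), θ (σ • P) = σ • θ P)
    (hiff : ∀ c' : galH1Torsion W' (p : ℤ),
      c' ∈ selmerLocalKer W' L (p : ℤ) ↔ h1Equiv θ hθ c' ∈ selmerLocalKer W L (p : ℤ))
    {c : galH1Torsion W (p : ℤ)} (hc : c ∈ selmerLocalKer W L (p : ℤ)) :
    (h1Equiv θ hθ).symm c ∈ selmerLocalKer W' L (p : ℤ) := by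
  rw [hiff, AddEquiv.apply_symm_apply]
  exact hc

end General

section Rat

variable (W W' : WeierstrassCurve ℚ) [W.IsElliptic] [W'.IsElliptic] {p : ℕ} [hp : Fact p.Prime]

/-- **Selmer companions over `ℚ`, both curves GOOD at `p`.** `p` an odd prime, `θ : E'[p] ⥲ E[p]` a
`Γ_ℚ`-isomorphism, `S` a finite set of finite places containing the bad places of both curves and the
place above `p`, both curves of good reduction above `p`. If at every `v ∈ S` NOT above `p` the local
Selmer conditions agree along `θ` (as an `iff`), then `#Sel^(p)(E'/ℚ) = #Sel^(p)(E/ℚ)`; the agreement ABOVE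
`p` is Mazur–Rubin 2015 Thm. 3.1 (iv)(b) (`e(ℚ_p/ℚ_p) = 1 < p − 1`), the named fact `hMR`
(`selmerLocalKer_iff_of_goodReduction_above_rat`). CONDITIONAL on `hMR`. The N2 use (`p = 3`): `E` an
N2 cell, `A` a `3`-congruent curve good at `3` with `3 ∤ ∏ c_ℓ(A)`; the `v ∤ 3` agreements are the
tree's criteria (good/good; additive with `E(ℚ_v)[3] = 0` on both sides; non-split multiplicative vs
good, Fisher 2016 Thm. 4.4 as proved by n1011). [cite: MazurRubin2015SelmerCompanions, Thm. 3.1 (iv)(b)] -/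
theorem natCard_selmerGroup_eq_of_congr_of_agree_rat
    (hMR : selmerLocalKer_iff_of_goodReduction_above) (hp2 : p ≠ 2)
    (θ : geomTorsion W' (p : ℤ) ≃+ geomTorsion W (p : ℤ))
    (hθ : ∀ (σ : absoluteGaloisGroup ℚ) (P : geomTorsion W' (p : ℤ)), θ (σ • P) = σ • θ P)
    (S : Finset (HeightOneSpectrum (𝓞 ℚ)))
    (hS : ∀ v : HeightOneSpectrum (𝓞 ℚ), v ∉ S →
      W.HasGoodReductionAt v ∧ W'.HasGoodReductionAt v ∧ (p : 𝓞 ℚ) ∉ v.asIdeal)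
    (hgood : ∀ v : HeightOneSpectrum (𝓞 ℚ), (p : 𝓞 ℚ) ∈ v.asIdeal →
      W.HasGoodReductionAt v ∧ W'.HasGoodReductionAt v)
    (hagree : ∀ v ∈ S, (p : 𝓞 ℚ) ∉ v.asIdeal → ∀ c' : galH1Torsion W' (p : ℤ),
      c' ∈ selmerLocalKer W' (v.adicCompletion ℚ) (p : ℤ) ↔
        h1Equiv θ hθ c' ∈ selmerLocalKer W (v.adicCompletion ℚ) (p : ℤ)) :
    Nat.card (W'.selmerGroup (p : ℤ)) = Nat.card (W.selmerGroup (p : ℤ)) := by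
  -- the `iff` at every place of `S`: above `p` by `hMR`, elsewhere by hypothesis
  have hiff : ∀ v ∈ S, ∀ c' : galH1Torsion W' (p : ℤ),
      c' ∈ selmerLocalKer W' (v.adicCompletion ℚ) (p : ℤ) ↔
        h1Equiv θ hθ c' ∈ selmerLocalKer W (v.adicCompletion ℚ) (p : ℤ) := by
    intro v hv c'
    by_cases hpv : (p : 𝓞 ℚ) ∈ v.asIdeal
    · exact selmerLocalKer_iff_of_goodReduction_above_rat hMR W W' hp2 θ hθ v hpv (hgood v hpv).1
        (hgood v hpv).2 c'
    · exact hagree v hv hpv c'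
  exact natCard_selmerGroup_eq_of_congr_of_agree W W' hp2 θ hθ S hS
    (fun v hv c hc ↦ (hiff v hv c).mp hc)
    (fun v hv c hc ↦ symm_mem_selmerLocalKer_of_iff W W' θ hθ (hiff v hv) hc)

end Rat

end Summit.BirchSwinnertonDyer.Rank1Residual.X10.SelmerCompanions

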